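import Summits.CriticalPhenomena.PercolationContinuityZ3.Theorems.PercNearOneGluingNoHeavyLowerTailThreeSumGlue
import Summits.CriticalPhenomena.PercolationContinuityZ3.Theorems.PercNearOneGluingNoHeavyLowerTailThreeSumCount
import Summits.CriticalPhenomena.PercolationContinuityZ3.Theorems.PercNearOneGluingNoHeavyLowerTailAPLSeriesClusters
import HarnessLib

/-!
# `NoHeavyLowerTail` (stmt-CriticalPhenomena-4575) — 2-sums through the apex, part 1:
# cluster counts, join rules and the separation rule for two arms glued along `{a, h}`

Support file (prover prim-gen-kcluster gen 72; `--supports stmt-CriticalPhenomena-4575`).  Pure graph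
combinatorics: no measures, no definitions, no named facts, no sorries.

SETTING (the "apex–hub 2-cut" of KCLUSTER-gen65 §0.3 / gen69 §5, now at the level of configurations).
Finite vertex type `V`; an apex `a` and a hub `h ≠ a`; two edge supports `DX DY : Finset (Sym2 V)` (the ARMS)
MEETING ONLY IN `{a, h}` (`hsepD`); a terminal `b` private to the arm `X` (no pair of `DY` contains `b`) and a
terminal `c` private to the arm `Y`.  A configuration `ω ⊆ DX ∪ DY` has the blocks `ζ_X = ω ∩ DX`,
`ζ_Y = ω ∖ DX`.  Clusters are `Gladkov.cl`, support separation is `RefinedRowR3.Sep` (as in `SepDual`,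
`RCFolding`, `ThreeSum`).

* `ApexTwoSum.clusterCount_empty_eq_wired_two` — FREE VERSUS WIRED AT TWO POINTS: `k(ω) = k^{{a,h}}(ω) + [a ↮ h]`.
* `ApexTwoSum.kT_add` — inside the support the `{a,h}`-wired counts of the blocks add
  (`ThreeSum.clusterCount_union_add_wired`): `k^T(ω) + k^T(∅) = k^T(ζ_X) + k^T(ζ_Y)`, `T = {a,h}`.
* `ApexTwoSum.glued_h_iff / glued_b_iff / glued_c_iff` — the JOIN RULES (event forms of the tree's
  `APL.series_oc_iff / series_ou_iff / series_ov_iff`): `h ∈ C(a)` iff in some arm; `b ∈ C(a)` iff `b ∈ C_X(a)`, or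
  `b ∈ C_X(h)` and `h ∈ C(a)`; symmetrically for `c`.
* `ApexTwoSum.sep_two_iff` — the SEPARATION RULE: if `h ∉ C(a)` then `C(a)` meets every `b–c` path of
  `DX ∪ DY` iff `C_X(a)` meets every `b–h` path of `DX` OR `C_Y(a)` meets every `c–h` path of `DY` (a `b–c` path
  avoiding `a` crosses from arm to arm exactly at `h`); `ApexTwoSum.sep_two_of_mem` — if `h ∈ C(a)` (and
  `b, c ∉ C(a)`) then `C(a) ∋ a, h` meets every `b–c` path.
Parts 2–4 turn these into the dictionary "cells of the glued measure = bilinear forms in the arms' wired cells" and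
apply the kernel certificate `ThetaBlocks.R10_cert` (p367913).
-/

namespace Summit.CriticalPhenomena.PercolationContinuityZ3.Theorems

namespace ApexTwoSum

open SimpleGraph Finset Literature.Probability.Percolation Literature.Probability.Percolation.Gladkov
open Literature.Probability.LatticeModels RefinedRowR3 ThreePointLB APL
open scoped Classical

variable {V : Type*}

/-! ### Free versus wired count at two points -/

section Count

variable {a h : V}

/-- Wiring `{a, h}` is adding the edge `ah` (for `a ≠ h`). [folklore] -/
theorem sup_wired_two_eq (hah : a ≠ h) (H : SimpleGraph V) :
    H ⊔ wired ({a, h} : Set V) = H ⊔ edge a h := by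
  ext x y
  simp only [sup_adj, wired_adj, edge_adj, Set.mem_insert_iff, Set.mem_singleton_iff, ne_eq]
  constructor
  · rintro (hxy | ⟨hne, hx, hy⟩)
    · exact Or.inl hxy
    · rcases hx with rfl | rfl <;> rcases hy with rfl | rfl <;> tauto
  · rintro (hxy | ⟨hxy, hne⟩)
    · exact Or.inl hxy
    · rcases hxy with ⟨rfl, rfl⟩ | ⟨rfl, rfl⟩ <;> exact Or.inr ⟨hne, by tauto⟩

/-- **Free versus wired count at two points.**  For `a ≠ h` and every configuration `ω`,
`k(ω) = k^{{a,h}}(ω) + [a ↮ h]`. [this work] -/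
theorem clusterCount_empty_eq_wired_two [Finite V] (hah : a ≠ h) (ω : BondConfig V)
    [Decidable ((openGraph ω).Reachable a h)] :
    clusterCount ω ∅ = clusterCount ω ({a, h} : Set V) + (if (openGraph ω).Reachable a h then 0 else 1) := by
  have h1 := ThreeSum.card_cc_sup_edge (openGraph ω) a h
  unfold clusterCount
  rw [wired_empty, sup_bot_eq, sup_wired_two_eq hah]
  omega

variable [Fintype V]

/-- On `{h ∈ C(a)}`: `k(ω) = k^{{a,h}}(ω)`. [this work] -/
theorem k_of_mem (hah : a ≠ h) (ω : BondConfig V) (hh : h ∈ cl ω.toFinset a) :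
    clusterCount ω ∅ = clusterCount ω ({a, h} : Set V) := by
  rw [mem_cl, Set.coe_toFinset] at hh
  have h1 := clusterCount_empty_eq_wired_two hah ω
  rw [if_pos hh] at h1
  omega

/-- On `{h ∉ C(a)}`: `k(ω) = k^{{a,h}}(ω) + 1`. [this work] -/
theorem k_of_not_mem (hah : a ≠ h) (ω : BondConfig V) (hh : h ∉ cl ω.toFinset a) :
    clusterCount ω ∅ = clusterCount ω ({a, h} : Set V) + 1 := by
  rw [mem_cl, Set.coe_toFinset] at hh
  have h1 := clusterCount_empty_eq_wired_two hah ω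
  rw [if_neg hh] at h1
  omega

end Count

/-! ### Blocks of a glued configuration -/

section Blocks

variable [Fintype V] {DX DY : Finset (Sym2 V)} {a h b c : V}
  (hsepD : ∀ v : V, (∃ e ∈ DX, v ∈ e) → (∃ e ∈ DY, v ∈ e) → (v = a ∨ v = h))
include hsepD

/-- Inside the glued support the `Y`-block lies in `DY` and the blocks meet only in `{a, h}`. [this work] -/
theorem blocks_hsep {ω : BondConfig V} (hω : ω ⊆ ↑DX ∪ ↑DY) :
    (ω ∩ (↑DX : Set (Sym2 V))).toFinset ⊆ DX ∧ (ω \ (↑DX : Set (Sym2 V))).toFinset ⊆ DY ∧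
      (∀ v : V, (∃ e ∈ (ω ∩ (↑DX : Set (Sym2 V))).toFinset, v ∈ e) →
        (∃ e ∈ (ω \ (↑DX : Set (Sym2 V))).toFinset, v ∈ e) → (v = a ∨ v = h)) := by
  have hA : (ω ∩ (↑DX : Set (Sym2 V))).toFinset ⊆ DX := fun e he => by
    rw [Set.mem_toFinset] at he; exact he.2
  have hB : (ω \ (↑DX : Set (Sym2 V))).toFinset ⊆ DY := fun e he => by
    rw [Set.mem_toFinset] at he
    rcases hω he.1 with h' | h'
    · exact absurd h' he.2
    · exact h'
  exact ⟨hA, hB, fun v ⟨e, he, hve⟩ ⟨e', he', hve'⟩ => hsepD v ⟨e, hA he, hve⟩ ⟨e', hB he', hve'⟩⟩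

/-- **The `{a,h}`-wired counts of the blocks add** (inside the support):
`k^T(ω) + k^T(∅) = k^T(ω ∩ DX) + k^T(ω ∖ DX)`, `T = {a, h}`. [this work] -/
theorem kT_add {ω : BondConfig V} (hω : ω ⊆ ↑DX ∪ ↑DY) :
    clusterCount ω ({a, h} : Set V) + clusterCount (∅ : BondConfig V) ({a, h} : Set V) =
      clusterCount (ω ∩ ↑DX) ({a, h} : Set V) + clusterCount (ω \ ↑DX) ({a, h} : Set V) := by
  obtain ⟨hA, hB, hsep⟩ := blocks_hsep hsepD hω
  have hmeet : ∀ e ∈ ω ∩ (↑DX : Set (Sym2 V)), ∀ e' ∈ ω \ (↑DX : Set (Sym2 V)), ∀ x, x ∈ e → x ∈ e' →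
      x ∈ ({a, h} : Set V) := by
    intro e he e' he' x hx hx'
    have h1 := hsep x ⟨e, by rw [Set.mem_toFinset]; exact he, hx⟩ ⟨e', by rw [Set.mem_toFinset]; exact he', hx'⟩
    simp only [Set.mem_insert_iff, Set.mem_singleton_iff]; exact h1
  have key := ThreeSum.clusterCount_union_add_wired (T := ({a, h} : Set V)) hmeet (Set.mem_insert a _)
  rwa [Set.inter_union_sdiff] at key

end Blocks

/-! ### Join rules in event form -/

section Join

variable [Fintype V] {DX DY : Finset (Sym2 V)} {a h b c : V} (hab : a ≠ b) (hac : a ≠ c)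
  (hsepD : ∀ v : V, (∃ e ∈ DX, v ∈ e) → (∃ e ∈ DY, v ∈ e) → (v = a ∨ v = h))
  (hbY : ∀ e ∈ DY, b ∉ e) (hcX : ∀ e ∈ DX, c ∉ e)
include hsepD

/-- The blocks of a configuration inside the support, read off from the goal (any `Fintype` instances on the
blocks): `ω = ζ_X ∪ ζ_Y` as finite sets, `ζ_X ⊆ DX`, `ζ_Y ⊆ DY`, and the blocks meet only in `{a, h}`. [this work] -/
theorem blocks_of_eq {ω : BondConfig V} (hω : ω ⊆ ↑DX ∪ ↑DY) {ζX ζY : Finset (Sym2 V)}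
    (hX : ∀ e, e ∈ ζX ↔ e ∈ ω ∩ (↑DX : Set (Sym2 V))) (hY : ∀ e, e ∈ ζY ↔ e ∈ ω \ (↑DX : Set (Sym2 V))) :
    ω.toFinset = ζX ∪ ζY ∧ ζX ⊆ DX ∧ ζY ⊆ DY ∧
      (∀ v : V, (∃ e ∈ ζX, v ∈ e) → (∃ e ∈ ζY, v ∈ e) → (v = a ∨ v = h)) := by
  have hXD : ζX ⊆ DX := fun e he => ((hX e).1 he).2
  have hYD : ζY ⊆ DY := fun e he => by
    have he' := (hY e).1 he
    rcases hω he'.1 with h' | h'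
    · exact absurd h' he'.2
    · exact h'
  refine ⟨?_, hXD, hYD, fun v ⟨e, he, hve⟩ ⟨e', he', hve'⟩ => hsepD v ⟨e, hXD he, hve⟩ ⟨e', hYD he', hve'⟩⟩
  ext e
  rw [Set.mem_toFinset, Finset.mem_union, hX, hY, Set.mem_inter_iff, Set.mem_sdiff]
  tauto

/-- **Join rule for the hub**: `h ∈ C(a)` in `ω` iff `h ∈ C(a)` in some block. [this work] -/
theorem glued_h_iff {ω : BondConfig V} (hω : ω ⊆ ↑DX ∪ ↑DY) :
    h ∈ cl ω.toFinset a ↔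
      ((ω ∩ ↑DX) ∈ {η : BondConfig V | h ∈ cl η.toFinset a} ∨ (ω \ ↑DX) ∈ {η : BondConfig V | h ∈ cl η.toFinset a}) := by
  simp only [Set.mem_setOf_eq]
  suffices key : ∀ ζX ζY : Finset (Sym2 V), (∀ e, e ∈ ζX ↔ e ∈ ω ∩ (↑DX : Set (Sym2 V))) →
      (∀ e, e ∈ ζY ↔ e ∈ ω \ (↑DX : Set (Sym2 V))) → (h ∈ cl ω.toFinset a ↔ (h ∈ cl ζX a ∨ h ∈ cl ζY a)) by
    exact key _ _ (fun e => by simp only [Set.mem_toFinset]) (fun e => by simp only [Set.mem_toFinset])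
  intro ζX ζY hX hY
  obtain ⟨hωζ, -, -, hsep⟩ := blocks_of_eq hsepD hω hX hY
  rw [hωζ]
  exact APL.series_oc_iff _ _ a h hsep

include hab hbY in
/-- **Join rule for the terminal `b` (private to arm `X`)**: `b ∈ C(a)` iff `b ∈ C_X(a)`, or `h ∈ C_X(b)` and
`h ∈ C(a)` in some block. [this work] -/
theorem glued_b_iff {ω : BondConfig V} (hω : ω ⊆ ↑DX ∪ ↑DY) :
    b ∈ cl ω.toFinset a ↔
      ((ω ∩ ↑DX) ∈ {η : BondConfig V | b ∈ cl η.toFinset a} ∨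
        ((ω ∩ ↑DX) ∈ {η : BondConfig V | h ∈ cl η.toFinset b} ∧
          ((ω ∩ ↑DX) ∈ {η : BondConfig V | h ∈ cl η.toFinset a} ∨ (ω \ ↑DX) ∈ {η : BondConfig V | h ∈ cl η.toFinset a}))) := by
  simp only [Set.mem_setOf_eq]
  suffices key : ∀ ζX ζY : Finset (Sym2 V), (∀ e, e ∈ ζX ↔ e ∈ ω ∩ (↑DX : Set (Sym2 V))) →
      (∀ e, e ∈ ζY ↔ e ∈ ω \ (↑DX : Set (Sym2 V))) →
      (b ∈ cl ω.toFinset a ↔ (b ∈ cl ζX a ∨ (h ∈ cl ζX b ∧ (h ∈ cl ζX a ∨ h ∈ cl ζY a)))) by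
    exact key _ _ (fun e => by simp only [Set.mem_toFinset]) (fun e => by simp only [Set.mem_toFinset])
  intro ζX ζY hX hY
  obtain ⟨hωζ, -, hYD, hsep⟩ := blocks_of_eq hsepD hω hX hY
  rw [hωζ]
  exact APL.series_ou_iff _ _ a h b hsep (fun e he hbe => absurd hbe (hbY e (hYD he))) hab.symm

include hac hcX in
/-- **Join rule for the terminal `c` (private to arm `Y`)**: `c ∈ C(a)` iff `c ∈ C_Y(a)`, or `h ∈ C_Y(c)` and
`h ∈ C(a)` in some block. [this work] -/
theorem glued_c_iff {ω : BondConfig V} (hω : ω ⊆ ↑DX ∪ ↑DY) :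
    c ∈ cl ω.toFinset a ↔
      ((ω \ ↑DX) ∈ {η : BondConfig V | c ∈ cl η.toFinset a} ∨
        ((ω \ ↑DX) ∈ {η : BondConfig V | h ∈ cl η.toFinset c} ∧
          ((ω ∩ ↑DX) ∈ {η : BondConfig V | h ∈ cl η.toFinset a} ∨ (ω \ ↑DX) ∈ {η : BondConfig V | h ∈ cl η.toFinset a}))) := by
  simp only [Set.mem_setOf_eq]
  suffices key : ∀ ζX ζY : Finset (Sym2 V), (∀ e, e ∈ ζX ↔ e ∈ ω ∩ (↑DX : Set (Sym2 V))) →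
      (∀ e, e ∈ ζY ↔ e ∈ ω \ (↑DX : Set (Sym2 V))) →
      (c ∈ cl ω.toFinset a ↔ (c ∈ cl ζY a ∨ (h ∈ cl ζY c ∧ (h ∈ cl ζX a ∨ h ∈ cl ζY a)))) by
    exact key _ _ (fun e => by simp only [Set.mem_toFinset]) (fun e => by simp only [Set.mem_toFinset])
  intro ζX ζY hX hY
  obtain ⟨hωζ, hXD, -, hsep⟩ := blocks_of_eq hsepD hω hX hY
  rw [hωζ, APL.series_ov_iff _ _ a h c hsep (fun e he hce => absurd hce (hcX e (hXD he))) hac.symm]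
  constructor
  · rintro (h1 | ⟨h2, h3 | h3⟩)
    · exact Or.inl h1
    · exact Or.inr ⟨h2, Or.inr h3⟩
    · exact Or.inr ⟨h2, Or.inl h3⟩
  · rintro (h1 | ⟨h2, h3 | h3⟩)
    · exact Or.inl h1
    · exact Or.inr ⟨h2, Or.inr h3⟩
    · exact Or.inr ⟨h2, Or.inl h3⟩

end Join

/-! ### The separation rule -/

section Separation

variable [Fintype V] {DX DY ζX ζY : Finset (Sym2 V)} {a h b c : V}

/-- A vertex meeting no pair of `S` has a trivial cluster. [folklore] -/
theorem eq_of_mem_cl_of_forall_not_mem {S : Finset (Sym2 V)} {x y : V} (hx : ∀ e ∈ S, x ∉ e)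
    (hy : y ∈ cl S x) : y = x := by
  by_contra hne
  obtain ⟨e, he, hxe⟩ := exists_mem_edge_of_mem_cl (mem_cl_comm.1 hy) (Ne.symm hne)
  exact hx e he hxe

variable (hsepD : ∀ v : V, (∃ e ∈ DX, v ∈ e) → (∃ e ∈ DY, v ∈ e) → (v = a ∨ v = h))
  (hbY : ∀ e ∈ DY, b ∉ e) (hcX : ∀ e ∈ DX, c ∉ e) (hab : a ≠ b) (hbc : b ≠ c) (hhb : h ≠ b) (hhc : h ≠ c)
include hsepD hbY hcX hbc hhb hhc

/-- **Separation rule, hub outside the cluster.**  Let `ζ_X ⊆ DX`, `ζ_Y ⊆ DY` with `h ∉ C_X(a)`, `h ∉ C_Y(a)`.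
Then the glued cluster of `a` meets every `b–c` path of `DX ∪ DY` iff `C_X(a)` meets every `b–h` path of `DX`
or `C_Y(a)` meets every `c–h` path of `DY`. [this work] -/
theorem sep_two_iff (hζX : ζX ⊆ DX) (hζY : ζY ⊆ DY) (hhX : h ∉ cl ζX a) (hhY : h ∉ cl ζY a) :
    Sep (DX ∪ DY) (cl (ζX ∪ ζY) a) b c ↔ (Sep DX (cl ζX a) b h ∨ Sep DY (cl ζY a) c h) := by
  -- three-name forms of the gluing hypothesis (roles `(a; h, h)`)
  have hsep3 : ∀ v : V, (∃ e ∈ ζX, v ∈ e) → (∃ e ∈ ζY, v ∈ e) → (v = a ∨ v = h ∨ v = h) :=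
    fun v ⟨e, he, hve⟩ ⟨e', he', hve'⟩ => (hsepD v ⟨e, hζX he, hve⟩ ⟨e', hζY he', hve'⟩).imp id Or.inl
  have hsepD3 : ∀ v : V, (∃ e ∈ DX, v ∈ e) → (∃ e ∈ DY, v ∈ e) → (v = a ∨ v = h ∨ v = h) :=
    fun v h1 h2 => (hsepD v h1 h2).imp id Or.inl
  unfold RefinedRowR3.Sep
  rw [ThreeSum.cl_union_eq hsep3 hhX hhX hhY hhY, Finset.union_sdiff_distrib,
    ThreeSum.sdiff_touch_union_left hsepD3 hζY hhY hhY, ThreeSum.sdiff_touch_union_right hsepD3 hζX hhX hhX]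
  set EX := DX \ touch (cl ζX a) with hEX
  set EY := DY \ touch (cl ζY a) with hEY
  -- the two pieces off the clusters meet only in `h` (pairs at `a` are removed)
  have hsepE : ∀ x : V, (∃ e ∈ EX, x ∈ e) → (∃ e ∈ EY, x ∈ e) → (x = b ∨ x = h) := by
    rintro x ⟨e, he, hxe⟩ ⟨e', he', hxe'⟩
    rw [hEX, Finset.mem_sdiff] at he
    rw [hEY, Finset.mem_sdiff] at he'
    rcases hsepD x ⟨e, he.1, hxe⟩ ⟨e', he'.1, hxe'⟩ with rfl | rfl
    · exact absurd (mem_touch.2 ⟨x, mem_cl_self _ _, hxe⟩) he.2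
    · exact Or.inr rfl
  have hcEX : ∀ e ∈ EX, c ∈ e → c = h := fun e he hce => by
    rw [hEX, Finset.mem_sdiff] at he; exact absurd hce (hcX e he.1)
  have hbEY : ∀ e ∈ EY, b ∉ e := fun e he => by
    rw [hEY, Finset.mem_sdiff] at he; exact hbY e he.1
  have key := APL.series_ov_iff EX EY b h c hsepE hcEX hbc.symm
  rw [key]
  constructor
  · intro hn
    by_contra hcon
    rw [not_or, not_not, not_not] at hcon
    exact hn (Or.inr ⟨hcon.2, Or.inr hcon.1⟩)
  · rintro hor (h1 | ⟨h2, h3 | h3⟩)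
    · exact hbc.symm (eq_of_mem_cl_of_forall_not_mem hbEY h1)
    · exact hhb (eq_of_mem_cl_of_forall_not_mem hbEY h3)
    · rcases hor with hs | hs
      · exact hs h3
      · exact hs h2

/-- **Separation, hub inside the cluster.**  If `h ∈ C(a)` for a configuration `ω ⊆ DX ∪ DY`, then
`C(a) ∋ a, h` meets every `b–c` path of `DX ∪ DY` (every such path passes `a` or `h`). [this work] -/
theorem sep_two_of_mem (ω : BondConfig V) (hh : h ∈ cl ω.toFinset a) :
    Sep (DX ∪ DY) (cl ω.toFinset a) b c := by
  unfold RefinedRowR3.Sep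
  set K := cl ω.toFinset a with hK
  rw [Finset.union_sdiff_distrib]
  set EX := DX \ touch K with hEX
  set EY := DY \ touch K with hEY
  have haK : a ∈ K := mem_cl_self _ _
  -- the two pieces meet nowhere (pairs at `a` and `h` are removed)
  have hsepE : ∀ x : V, (∃ e ∈ EX, x ∈ e) → (∃ e ∈ EY, x ∈ e) → (x = b ∨ x = h) := by
    rintro x ⟨e, he, hxe⟩ ⟨e', he', hxe'⟩
    rw [hEX, Finset.mem_sdiff] at he
    rw [hEY, Finset.mem_sdiff] at he'
    rcases hsepD x ⟨e, he.1, hxe⟩ ⟨e', he'.1, hxe'⟩ with rfl | rfl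
    · exact absurd (mem_touch.2 ⟨x, haK, hxe⟩) he.2
    · exact absurd (mem_touch.2 ⟨x, hh, hxe⟩) he.2
  have hcEX : ∀ e ∈ EX, c ∈ e → c = h := fun e he hce => by
    rw [hEX, Finset.mem_sdiff] at he; exact absurd hce (hcX e he.1)
  have hbEY : ∀ e ∈ EY, b ∉ e := fun e he => by
    rw [hEY, Finset.mem_sdiff] at he; exact hbY e he.1
  have hhEY : ∀ e ∈ EY, h ∉ e := fun e he hhe => by
    rw [hEY, Finset.mem_sdiff] at he; exact he.2 (mem_touch.2 ⟨h, hh, hhe⟩)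
  rw [APL.series_ov_iff EX EY b h c hsepE hcEX hbc.symm]
  rintro (h1 | ⟨h2, -⟩)
  · exact hbc (eq_of_mem_cl_of_forall_not_mem hbEY h1).symm
  · have hch : c = h := eq_of_mem_cl_of_forall_not_mem hhEY (mem_cl_comm.1 h2)
    exact hhc hch.symm

/-- **Separation rule in event form** (blocks read off from the goal): inside the support, if `h ∉ C(a)` in both
blocks, the glued cluster of `a` meets every `b–c` path of `DX ∪ DY` iff `C_X(a)` meets every `b–h` path of `DX`
or `C_Y(a)` meets every `c–h` path of `DY`. [this work] -/
theorem glued_sep_iff {ω : BondConfig V} (hω : ω ⊆ ↑DX ∪ ↑DY)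
    (hhX : (ω ∩ ↑DX) ∉ {η : BondConfig V | h ∈ cl η.toFinset a})
    (hhY : (ω \ ↑DX) ∉ {η : BondConfig V | h ∈ cl η.toFinset a}) :
    Sep (DX ∪ DY) (cl ω.toFinset a) b c ↔
      ((ω ∩ ↑DX) ∈ {η : BondConfig V | Sep DX (cl η.toFinset a) b h} ∨
        (ω \ ↑DX) ∈ {η : BondConfig V | Sep DY (cl η.toFinset a) c h}) := by
  simp only [Set.mem_setOf_eq] at hhX hhY ⊢
  suffices key : ∀ ζX ζY : Finset (Sym2 V), (∀ e, e ∈ ζX ↔ e ∈ ω ∩ (↑DX : Set (Sym2 V))) →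
      (∀ e, e ∈ ζY ↔ e ∈ ω \ (↑DX : Set (Sym2 V))) → h ∉ cl ζX a → h ∉ cl ζY a →
      (Sep (DX ∪ DY) (cl ω.toFinset a) b c ↔ (Sep DX (cl ζX a) b h ∨ Sep DY (cl ζY a) c h)) by
    exact key _ _ (fun e => by simp only [Set.mem_toFinset]) (fun e => by simp only [Set.mem_toFinset]) hhX hhY
  intro ζX ζY hX hY hhX' hhY'
  have hXD : ζX ⊆ DX := fun e he => ((hX e).1 he).2
  have hYD : ζY ⊆ DY := fun e he => by
    have he' := (hY e).1 he
    rcases hω he'.1 with h' | h'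
    · exact absurd h' he'.2
    · exact h'
  have hωζ : ω.toFinset = ζX ∪ ζY := by
    ext e
    rw [Set.mem_toFinset, Finset.mem_union, hX, hY, Set.mem_inter_iff, Set.mem_sdiff]
    tauto
  rw [hωζ]
  exact sep_two_iff hsepD hbY hcX hbc hhb hhc hXD hYD hhX' hhY'

omit hsepD hbY hcX hbc hhb hhc in
/-- An open `b–h` path off `C_X(a)` in the `X`-block defeats separation in `DX` (event form of
`ThreeSum.not_sep_of_mem_cl`). [this work] -/
theorem not_sepX_of_mem {ω : BondConfig V}
    (hb : (ω ∩ ↑DX) ∉ {η : BondConfig V | b ∈ cl η.toFinset a})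
    (hδ : (ω ∩ ↑DX) ∈ {η : BondConfig V | h ∈ cl η.toFinset b}) :
    (ω ∩ ↑DX) ∉ {η : BondConfig V | Sep DX (cl η.toFinset a) b h} := by
  simp only [Set.mem_setOf_eq] at hb hδ ⊢
  suffices key : ∀ ζ : Finset (Sym2 V), (∀ e, e ∈ ζ ↔ e ∈ ω ∩ (↑DX : Set (Sym2 V))) →
      b ∉ cl ζ a → h ∈ cl ζ b → ¬ Sep DX (cl ζ a) b h by
    exact key _ (fun e => by simp only [Set.mem_toFinset]) hb hδ
  intro ζ hζ hb' hδ'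
  exact ThreeSum.not_sep_of_mem_cl (fun e he => ((hζ e).1 he).2) hb' hδ'

omit hsepD hbY hcX hbc hhb hhc in
/-- An open `c–h` path off `C_Y(a)` in the `Y`-block defeats separation in `DY`. [this work] -/
theorem not_sepY_of_mem {ω : BondConfig V} (hω : ω ⊆ ↑DX ∪ ↑DY)
    (hc : (ω \ ↑DX) ∉ {η : BondConfig V | c ∈ cl η.toFinset a})
    (hδ : (ω \ ↑DX) ∈ {η : BondConfig V | h ∈ cl η.toFinset c}) :
    (ω \ ↑DX) ∉ {η : BondConfig V | Sep DY (cl η.toFinset a) c h} := by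
  simp only [Set.mem_setOf_eq] at hc hδ ⊢
  suffices key : ∀ ζ : Finset (Sym2 V), (∀ e, e ∈ ζ ↔ e ∈ ω \ (↑DX : Set (Sym2 V))) →
      c ∉ cl ζ a → h ∈ cl ζ c → ¬ Sep DY (cl ζ a) c h by
    exact key _ (fun e => by simp only [Set.mem_toFinset]) hc hδ
  intro ζ hζ hc' hδ'
  refine ThreeSum.not_sep_of_mem_cl (fun e he => ?_) hc' hδ'
  have he' := (hζ e).1 he
  rcases hω he'.1 with h' | h'
  · exact absurd h' he'.2
  · exact h'

end Separation

end ApexTwoSum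

end Summit.CriticalPhenomena.PercolationContinuityZ3.Theorems
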